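import Mathlib
import Summits.KontsevichZagierPeriods.Zeta5Search.ZeroWindowClasses
import Summits.KontsevichZagierPeriods.Zeta5Search.ZeroWindowKit
import Summits.KontsevichZagierPeriods.Zeta5Search.AtlasRayRecord
import Summits.KontsevichZagierPeriods.Zeta5Search.CellKitCentre
import Summits.KontsevichZagierPeriods.Zeta5Search.TypeSpaceWindows
import Summits.KontsevichZagierPeriods.Zeta5Search.TSWindowZ68P1
import Summits.KontsevichZagierPeriods.Zeta5Search.TSWindowZ68P2
import Summits.KontsevichZagierPeriods.Zeta5Search.TSWindowZ68P3
import Summits.KontsevichZagierPeriods.Zeta5Search.TSWindowZ68P4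
import Summits.KontsevichZagierPeriods.Zeta5Search.TSWindowZ68P5
import Summits.KontsevichZagierPeriods.Zeta5Search.TSWindowZ68P6
import Summits.KontsevichZagierPeriods.Zeta5Search.TSWindowZ68P7
import Summits.KontsevichZagierPeriods.Zeta5Search.TSWindowZ68P8
import Summits.KontsevichZagierPeriods.Zeta5Search.TSWindowZ68P9
import HarnessLib

/-!
# ζ(5) search — type-space (zero regime; θ < 2) record window `M = 68` of `TypeSpaceWindows.lean`: `RecTSClassesZ68` (part 10/10) (HONEST FRAMING: systematic search; no irrationality claim unless certified)

Cell `pub-zeta5`, prover seat p3 generation 3.  MACHINE-GENERATED by `code/gen/zwgen.py` (p3 g3) in the format of P1's atlas machine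
(`AtlasCellRec*`): exact scale-free class analysis of the record ray `bRec n = bLin (11n) (7n) n` on the window `3 * n < 4 * p`, `33 * p ≤ 25 * n`
(all odd `p`, all `n ≤ 300`: 155 instances; class lengths `[54, 55]`, bracket signatures per length `{54: 13, 55: 6}`), every statement then
PROVED (`omega` leaf by leaf).  Bracket classification generated afresh (one LEAF theorem per signature, decision tree inline in `zw_L*`).
Target: census g21's `@[conjecture]` node `ZeroWindows.RecZeroClassesM68` (deep palindromes `D68`, extra pair `S68`) and hence
`ResidueLaw.RecWindowM68` by the landed reduction `ZeroWindows.recWindowM68_of`.  Integer bookkeeping (`netExp` along residue classes);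
valuations of rationals; nothing here bears on irrationality.
-/

open Finset

namespace Summit.KontsevichZagierPeriods.Zeta5Search.TSWindowZ68

open Summit.KontsevichZagierPeriods.Zeta5Search.ClusterValuation (netExp classSet CentreIn classExp conjClass bRec classPoleCount)
open Summit.KontsevichZagierPeriods.Zeta5Search.CasoratianValuation (InPolytope shift casoratian)
open Summit.KontsevichZagierPeriods.Zeta5Search.CellKit
open Summit.KontsevichZagierPeriods.Zeta5Search.SecondOrder (classTypeList isRaise classTypeList_level)
open Summit.KontsevichZagierPeriods.Zeta5Search.AtlasRayRecord
open Summit.KontsevichZagierPeriods.Zeta5Search.ResidueLaw (RecTSClassesZ68 RecWindowTSM68 recWindowTSM68_of)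
open Summit.KontsevichZagierPeriods.Zeta5Search.ZeroWindows

variable {p : ℕ} [hp : Fact p.Prime]

/-- **Class structure of the window** (`3 * n < 4 * p`, `33 * p ≤ 25 * n`; at EVERY instance, the `DepthRealised` guard is not needed):
`ZeroWindowClasses (bRec n) p 68 D68 S68`. -/
theorem zeroClasses (n p : ℕ) (_hn : 2 ≤ n) (hprime : p.Prime) (h1 : 3 * n < 4 * p) (h2 : 33 * p ≤ 25 * n) :
    ZeroWindowClasses (bRec n) p 68 D68 S68 := by
  haveI : Fact p.Prime := ⟨hprime⟩
  have hp2 : p % 2 = 1 := Nat.odd_iff.1 (hprime.odd_of_ne_two (by omega))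
  rw [bRec_eq_bLin]
  unfold ZeroWindowClasses
  refine ⟨fun x hx _ => ?_, fun x hx _ hE => ?_, fun x hx _ hE => ?_⟩
  · rcases Nat.lt_or_ge (41 * n) (x + 54 * p) with hL54 | hL54
    · have h := (zw_L53 h1 h2 hp2 hx (by omega) (by omega)).1
      omega
    · have h := (zw_L54 h1 h2 hp2 hx (by omega) (by omega)).1
      omega
  · rcases Nat.lt_or_ge (41 * n) (x + 54 * p) with hL54 | hL54
    · exact (zw_L53 h1 h2 hp2 hx (by omega) (by omega)).2.1 (by omega)
    · exact (zw_L54 h1 h2 hp2 hx (by omega) (by omega)).2.1 (by omega)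
  · rcases Nat.lt_or_ge (41 * n) (x + 54 * p) with hL54 | hL54
    · exact (zw_L53 h1 h2 hp2 hx (by omega) (by omega)).2.2 (by omega)
    · exact (zw_L54 h1 h2 hp2 hx (by omega) (by omega)).2.2 (by omega)

/-- **`ResidueLaw.RecTSClassesZ68` IS A THEOREM** (bookkeeping of the zero type-space window `M = 68`, `3 * n < 4 * p`,
    `33 * p ≤ 25 * n`): the class structure
`zeroClasses` gives (G1), palindromic centre-free deep classes (the one deep type of `D68`), and (h7) with `affDet = 0` EXACTLY by
census g21's pigeonhole `ZeroWindows.affDet_eq_zero_of_classes` (two point values). -/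
theorem recTSClassesZ68_holds : RecTSClassesZ68 := by
  intro n p hn hprime h1 h2 _hsq _hdr
  haveI : Fact p.Prime := ⟨hprime⟩
  have hC := zeroClasses n p hn hprime h1 h2
  have hpn : (p : ℤ) ≤ bRec n 0 := by
    rw [show bRec n 0 = 41 * (n : ℤ) by simp [bRec, mul_comm]]; exact_mod_cast (show p ≤ 41 * n by omega)
  refine ⟨hC.1, fun x hx hpole hE => ⟨(hC.2.1 x hx hpole hE).1, ?_⟩, fun x hx y hy z hz => Or.inl ?_⟩
  · have hmem := (hC.2.1 x hx hpole hE).2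
    simp only [D68, List.mem_cons, List.not_mem_nil, or_false] at hmem
    rw [hmem]; decide
  · exact affDet_eq_zero_of_classes (bRec n) (ClusterValuation.inPolytope_bRec n) hpn (by norm_num : 6 ≤ 68) (by decide) (by decide) hC
      (by decide) x hx y hy z hz
/-- **`ResidueLaw.RecWindowTSM68` IS A THEOREM**: `v_p(Cas₇(b(n))) ≥ -130` on the window (gen-2 g13's reduction `recWindowTSM68_of` +
`typeSpaceLawZero_holds`). -/
theorem recWindowTSM68_holds : RecWindowTSM68 := recWindowTSM68_of recTSClassesZ68_holds

end Summit.KontsevichZagierPeriods.Zeta5Search.TSWindowZ68
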